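import Summits.BirchSwinnertonDyer.BirchSwinnertonDyer.Theorems.SignedLowerHalvesKobayashiLowerHalfLargeImageParityStratumFE
import Summits.BirchSwinnertonDyer.BirchSwinnertonDyer.Theorems.SignedLowerHalvesKobayashiMainConjectureSmallImageSignedMuConjA
import HarnessLib

/-!
# Route `SignedLowerHalves` (K3), crux 4 `KobayashiMainConjectureSmallImage` (item stmt-BirchSwinnertonDyer-19002):
# the PARITY STRATUM AT SMALL IMAGE — Kobayashi's MAIN CONJECTURE (the equality, crux 4's currency) at EVERY
# odd good supersingular pair with `a_p = 0` carrying a certificate `(μ, λ)(L_p^ε) = (0, ≤ 1)`, ANY image, ANY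
# rank, GRANTED Coates–Sujatha's Conjecture A; and crux 4 BY NAME ⟺ its OFF-STRATUM part modulo Conjecture A

Cell `bsd-ssimc`, seat `bsd-line-slh-p3` LEAD gen 12 (helper file `--supports stmt-BirchSwinnertonDyer-19002`;
CALIBRATION / SUPPORT ONLY, pen rule D34-4 (3): no stub of the line of record `birth_acns` v13 is touched). HONEST
FRAMING: crux 4 is OPEN and nothing here proves it for the class; every theorem is CONDITIONAL on DISPLAYED binders —
the published named facts Kobayashi 2003 Thm. 1.2 (`h12`), Thm. 4.1 (`h41`, RATIONAL display only: no image
hypothesis is ever used), Thm. 6.2/6.3/7.3 ζ-package (`hCK`), the period-unit facts (`h5`, `h3`), the `p`-parity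
theorem (`hpar`), and Coates–Sujatha's CONJECTURE A at `(E, p)` (fine Selmer `μ = 0`; the tree node
`Rank1Residual.FineSelmer.CoatesSujathaConjectureA` or its per-pair spelling) — plus ONE per-pair certificate.
THEOREMS ONLY; no definition, no named fact, no `sorry`; BSD / crux 4 NOT proved.

## Why (the small-image twin of crux 3's parity-stratum calibration, `…LargeImageParityStratum{,MainConjecture,FE,Crux}`)

Seat `bsd-line-slh-p1` LEAD g12 proved for crux 3: the Eisenstein half `KobayashiLowerDivisibility W p ε` holds at
every pair with `(μ, λ)(L_p^ε) = (0, ≤ 1)` granted `h12`/`h5`/`h3`/`hpar` — NO image, rank or Kato hypothesis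
(`kobayashiLowerDivisibility_of_lam_le_one'`; `T ∣ ξ^ε` by parity, Sprung's functional equation a tree theorem) —
and the full main conjecture there WITH `Surj W p` (integral Kato via Wuthrich Lemma 20). Crux 4 (small image:
`¬ Surj W p`, image `= C_ns⁺(p)` exactly) wants the EQUALITY `∃ ε, KobayashiMainConjecture W p ε`, and Kato's
inclusion is only rational there (`pⁿ L_p^ε ∈ Char X^ε`): the missing `p`-power is a `μ`-statement. Width lane B
(`bsd-ssimc-k3-c4x`, parts 6–7) proved `KobayashiMainConjecture W p ε ⟸ KobayashiLowerDivisibility W p ε ∧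
Conjecture A at (E, p)` modulo `hCK h12 h41 h5 h3`, ANY image (`kobayashiMainConjecture_of_conjectureA_of_lowerDivisibility`).
Composing the two: **at a small-image pair ON the parity stratum, crux 4's conclusion holds modulo PRINT + Conjecture A
— the two-variable engines (children 23115 / 23116), the one-sign analytic `μ`-rider (23117) and the `p = 3` `λ`-part
(23118) are NOT needed there.** So the content of item 19002 beyond Conjecture A is carried entirely by the OFF-STRATUM
small-image pairs (both signs with `λ ≥ 2` or `μ ≥ 1`), exactly as crux 3's is (`…LargeImageParityStratumCrux`).

## What is proved

* §1 (per pair; odd good `p`, `a_p = 0`; ANY image, ANY rank) `kobayashiMainConjecture_of_lam_le_one_of_conjectureA`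
  (certificate `(μ, λ)(L_p^ε) = (0, ≤ 1)` for the newform of level `N_E` ⟹ `KobayashiMainConjecture W p ε`, granted
  `hCK h12 h41 h5 h3 hpar` + Conjecture A at `(E, p)`), `…_of_coatesSujathaConjectureA` (the node BY NAME),
  `kobayashiMainConjecture_neg_one_of_mazurTate_of_conjectureA` / `…_one_…` (the certificate as ONE Mazur–Tate
  element `Θ`, `μ(Θ) = 0`, `λ(Θ) = deg ω_n^± + l < pⁿ`, `l ≤ 1`).
* §2 `X7.exists_kobayashiMainConjecture_of_lam_le_one_of_conjectureA` — crux 4's conclusion `∃ ε, …` in its own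
  binder shape (`ClassX7`, `¬CM`, `a_p = 0`, `¬Surj` displayed; the last two image/CM binders unused).
* §3 `kobayashiMainConjectureSmallImage_of_offStratum_of_conjectureA` / `…_of_coatesSujathaConjectureA` — crux 4 BY
  NAME ⟸ Conjecture A on the domain ∧ `hCK h12 h41 h5 h3` ∧ `hpar` ∧ «every OFF-stratum small-image pair has
  `∃ ε, KobayashiLowerDivisibility W p ε`»; `offStratum_of_kobayashiMainConjectureSmallImage` (converse, trivial);
  `kobayashiMainConjectureSmallImage_iff_offStratum` (the reading as an `↔` modulo the binders).

References: [Kobayashi2003] Thm. 1.2, Thm. 4.1, Conjecture (p. 2), Thm. 6.2–6.3, 7.3–7.4; [Pollack2003] Prop. 6.9,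
6.10, 6.18; [Sprung2017] Cor. 4.14; [DokchitserDokchitserAnnals2010] Thm. 1.4; [CoatesSujatha2005] Conjecture A,
Thm. 3.4; [GreenbergVatsal2000] p. 4; [Kato2004Asterisque] Thm. 12.6, §17.13. Tree: the five
`…LargeImageParityStratum*` files (slh-p1 LEAD g12), `…SmallImageSignedMuDefect` / `…SignedMuConjA` (k3-c4x parts 6–7).
-/

set_option autoImplicit false
set_option linter.dupNamespace false

noncomputable section

open scoped Classical MatrixGroups ModularForm

open CongruenceSubgroup PowerSeries WeierstrassCurve Field Literature.NumberTheory.EllipticCurves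
  Literature.NumberTheory.EllipticCurves.ModularForms
  Literature.NumberTheory.EllipticCurves.Rank1Residual Literature.NumberTheory.EllipticCurves.Sprung2017
  Literature.NumberTheory.EllipticCurves.Kobayashi2003 ZpExtension
  Literature.NumberTheory.EllipticCurves.Rank1Residual.Typed
  Summit.BirchSwinnertonDyer.Rank1Residual.X1.MuLambda
  Summit.BirchSwinnertonDyer.Rank1Residual.Supersingular

namespace Summit.BirchSwinnertonDyer.BirchSwinnertonDyer.Theorems.SmallImageParityStratum

/-! ## §1. The main conjecture at a `(0, ≤ 1)`-certified pair, ANY image, granted Conjecture A -/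

section PerPair

variable (W : WeierstrassCurve ℚ) [W.IsElliptic] [W.IsGloballyMinimal] (p : ℕ) [Fact p.Prime]

/-- **Kobayashi's main conjecture for `(E, p, ε)` at a `(0, ≤ 1)`-certified pair — ANY image of `ρ̄_{E,p}`, ANY
rank — granted Conjecture A at `(E, p)`.** Let `p` be an odd good prime of `E = W` with `a_p = 0`, `f₀` the newform
of level `N_E`, and suppose Pollack's `L_p^ε` (the unique `L` with `IsSignedPAdicLFunction f₀ p ε L`) has `μ = 0`
and `λ ≤ 1`. Granted BY NAME: Kobayashi Thm. 1.2 (`h12`), Thm. 4.1 (`h41`, only its rational display is used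
downstream), the ζ-package (`hCK`), the period units (`h5`, `h3`), `p`-parity (`hpar`), and Conjecture A in the
per-pair spelling `hA` (for the cyclotomic `κ`, SOME dual fine Selmer datum is `ℤ_p`-finitely generated). Then
`KobayashiMainConjecture W p ε`. Proof: `LargeImageParityStratum.kobayashiLowerDivisibility_of_lam_le_one'` (the
Eisenstein half by parity; no image hypothesis) then `SmallImageSignedMuDefect.kobayashiMainConjecture_of_conjectureA_of_lowerDivisibility`
(Kato's rational inclusion + Coleman/ζ `μ`-squeeze against `μ(X₀) = 0`). CONDITIONAL; nothing else assumed.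
[cite: Kobayashi2003, Thm. 1.2, Thm. 4.1 and Conjecture (p. 2)] [cite: CoatesSujatha2005, Conjecture A]
[cite: DokchitserDokchitserAnnals2010, Thm. 1.4] [cite: Sprung2017, Cor. 4.14 (a_p = 0 display)] -/
theorem kobayashiMainConjecture_of_lam_le_one_of_conjectureA
    (hCK : thm62_63_73_signedColemanKato_zeta)
    (h12 : Kobayashi2003.thm12_signedSelmerDual_finite_torsion)
    (h41 : Kobayashi2003.thm41_signedCharIdeal_divisibility)
    (h5 : realPeriodRat_eq_unit_mul_plusPeriod) (h3 : realPeriodRat_eq_unit_mul_plusPeriod_three)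
    (hpar : p_parity W p) (hp : p ≠ 2) (hgood : W.HasGoodReductionAtPrime p) (hap : W.frobeniusTrace p = 0)
    (hA : ∀ (κ : ZpExtension ℚ p), κ.IsCyclotomic →
      ∃ (γ : absoluteGaloisGroup ℚ) (Y : W.FineSelmerDualData κ γ),
        Module.Finite ℤ_[p] (RestrictScalars ℤ_[p] (IwasawaAlgebra p) Y.X))
    (ε : ℤˣ) [NeZero (W.conductorNorm ℤ)] {f₀ : CuspForm (Gamma0 (W.conductorNorm ℤ)) 2} (hf₀ : IsNewformOf W f₀)
    (hcert₀ : ∀ L : IwasawaAlgebra p, IsSignedPAdicLFunction f₀ p ε L → mu L = 0 ∧ lam L ≤ 1) :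
    KobayashiMainConjecture W p ε :=
  SmallImageSignedMuDefect.kobayashiMainConjecture_of_conjectureA_of_lowerDivisibility W p hCK h12 h41 h5 h3 hp
    hgood hap hA
    (LargeImageParityStratum.kobayashiLowerDivisibility_of_lam_le_one' W p h12 h5 h3 hpar hp hgood hap ε hf₀ hcert₀)

/-- The same with **Conjecture A as the tree node BY NAME** (`Rank1Residual.FineSelmer.CoatesSujathaConjectureA`,
instantiated at `(ℚ, E, p)`). [cite: CoatesSujatha2005, Conjecture A] [cite: Kobayashi2003, Conjecture (p. 2)] -/
theorem kobayashiMainConjecture_of_lam_le_one_of_coatesSujathaConjectureA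
    (hA : Summit.BirchSwinnertonDyer.Rank1Residual.FineSelmer.CoatesSujathaConjectureA)
    (hCK : thm62_63_73_signedColemanKato_zeta)
    (h12 : Kobayashi2003.thm12_signedSelmerDual_finite_torsion)
    (h41 : Kobayashi2003.thm41_signedCharIdeal_divisibility)
    (h5 : realPeriodRat_eq_unit_mul_plusPeriod) (h3 : realPeriodRat_eq_unit_mul_plusPeriod_three)
    (hpar : p_parity W p) (hp : p ≠ 2) (hgood : W.HasGoodReductionAtPrime p) (hap : W.frobeniusTrace p = 0)
    (ε : ℤˣ) [NeZero (W.conductorNorm ℤ)] {f₀ : CuspForm (Gamma0 (W.conductorNorm ℤ)) 2} (hf₀ : IsNewformOf W f₀)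
    (hcert₀ : ∀ L : IwasawaAlgebra p, IsSignedPAdicLFunction f₀ p ε L → mu L = 0 ∧ lam L ≤ 1) :
    KobayashiMainConjecture W p ε :=
  kobayashiMainConjecture_of_lam_le_one_of_conjectureA W p hCK h12 h41 h5 h3 hpar hp hgood hap
    (fun κ hκ ↦ hA ℚ W p hp κ hκ) ε hf₀ hcert₀

/-- **The main conjecture for `(E, p, −1)` from ONE odd-level Mazur–Tate element, ANY image, granted Conjecture A**:
`Θ ∈ Λ` non-zero with `ι Θ = θ_n(f₀)`, `n` odd, `μ(Θ) = 0`, `λ(Θ) = deg ω_n^+ + l < pⁿ`, `l ≤ 1` (then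
`(μ, λ)(L_p^-) = (0, l)` in Kobayashi's labelling, `lam_signed_neg_one_eq_of_mazurTate`). CONDITIONAL on
`hCK h12 h41 h5 h3 hpar` + Conjecture A at `(E, p)`. [cite: Pollack2003, Prop. 6.9, 6.10 and 6.18]
[cite: Kobayashi2003, Thm. 1.2, Thm. 4.1 and Conjecture (p. 2)] [cite: CoatesSujatha2005, Conjecture A] -/
theorem kobayashiMainConjecture_neg_one_of_mazurTate_of_conjectureA
    (hCK : thm62_63_73_signedColemanKato_zeta)
    (h12 : Kobayashi2003.thm12_signedSelmerDual_finite_torsion)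
    (h41 : Kobayashi2003.thm41_signedCharIdeal_divisibility)
    (h5 : realPeriodRat_eq_unit_mul_plusPeriod) (h3 : realPeriodRat_eq_unit_mul_plusPeriod_three)
    (hpar : p_parity W p) (hp : p ≠ 2) (hgood : W.HasGoodReductionAtPrime p) (hap : W.frobeniusTrace p = 0)
    (hA : ∀ (κ : ZpExtension ℚ p), κ.IsCyclotomic →
      ∃ (γ : absoluteGaloisGroup ℚ) (Y : W.FineSelmerDualData κ γ),
        Module.Finite ℤ_[p] (RestrictScalars ℤ_[p] (IwasawaAlgebra p) Y.X))
    [NeZero (W.conductorNorm ℤ)] {f₀ : CuspForm (Gamma0 (W.conductorNorm ℤ)) 2} (hf₀ : IsNewformOf W f₀)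
    {n : ℕ} (hn : Odd n) {Θ : IwasawaAlgebra p}
    (hΘ : iwasawaToPowerSeries p Θ =
      ((mazurTateElement f₀ p n).map (algebraMap ℚ ℚ_[p]) : PowerSeries ℚ_[p]))
    (hΘ0 : Θ ≠ 0) (hμ : mu Θ = 0) {l : ℕ} (hl : l ≤ 1)
    (hlam : lam Θ = (cyclotomicOmegaPlus p n).natDegree + l) (hlt : lam Θ < p ^ n) :
    KobayashiMainConjecture W p (-1) :=
  SmallImageSignedMuDefect.kobayashiMainConjecture_of_conjectureA_of_lowerDivisibility W p hCK h12 h41 h5 h3 hp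
    hgood hap hA
    (LargeImageParityStratum.kobayashiLowerDivisibility_neg_one_of_mazurTate W p h12 h5 h3 hpar
      cor414_sharpFlat_functionalEquation_apZero_holds hp hgood hap hf₀ hn hΘ hΘ0 hμ hl hlam hlt)

/-- **The main conjecture for `(E, p, 1)` from ONE even-level Mazur–Tate element, ANY image, granted Conjecture A**
(`n` even, `λ(Θ) = deg ω_n^- + l < pⁿ`, `l ≤ 1`). [cite: Pollack2003, Prop. 6.9, 6.10 and 6.18]
[cite: Kobayashi2003, Thm. 1.2, Thm. 4.1 and Conjecture (p. 2)] [cite: CoatesSujatha2005, Conjecture A] -/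
theorem kobayashiMainConjecture_one_of_mazurTate_of_conjectureA
    (hCK : thm62_63_73_signedColemanKato_zeta)
    (h12 : Kobayashi2003.thm12_signedSelmerDual_finite_torsion)
    (h41 : Kobayashi2003.thm41_signedCharIdeal_divisibility)
    (h5 : realPeriodRat_eq_unit_mul_plusPeriod) (h3 : realPeriodRat_eq_unit_mul_plusPeriod_three)
    (hpar : p_parity W p) (hp : p ≠ 2) (hgood : W.HasGoodReductionAtPrime p) (hap : W.frobeniusTrace p = 0)
    (hA : ∀ (κ : ZpExtension ℚ p), κ.IsCyclotomic →
      ∃ (γ : absoluteGaloisGroup ℚ) (Y : W.FineSelmerDualData κ γ),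
        Module.Finite ℤ_[p] (RestrictScalars ℤ_[p] (IwasawaAlgebra p) Y.X))
    [NeZero (W.conductorNorm ℤ)] {f₀ : CuspForm (Gamma0 (W.conductorNorm ℤ)) 2} (hf₀ : IsNewformOf W f₀)
    {n : ℕ} (hn : Even n) {Θ : IwasawaAlgebra p}
    (hΘ : iwasawaToPowerSeries p Θ =
      ((mazurTateElement f₀ p n).map (algebraMap ℚ ℚ_[p]) : PowerSeries ℚ_[p]))
    (hΘ0 : Θ ≠ 0) (hμ : mu Θ = 0) {l : ℕ} (hl : l ≤ 1)
    (hlam : lam Θ = (cyclotomicOmegaMinus p n).natDegree + l) (hlt : lam Θ < p ^ n) :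
    KobayashiMainConjecture W p 1 :=
  SmallImageSignedMuDefect.kobayashiMainConjecture_of_conjectureA_of_lowerDivisibility W p hCK h12 h41 h5 h3 hp
    hgood hap hA
    (LargeImageParityStratum.kobayashiLowerDivisibility_one_of_mazurTate W p h12 h5 h3 hpar
      cor414_sharpFlat_functionalEquation_apZero_holds hp hgood hap hf₀ hn hΘ hΘ0 hμ hl hlam hlt)

end PerPair

/-! ## §2. Class X7 small-image readings, in the binder shape of crux 4 -/

section X7

variable (W : WeierstrassCurve ℚ) [W.IsElliptic] [W.IsGloballyMinimal] (p : ℕ) [Fact p.Prime]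

/-- **Crux 4's conclusion `∃ ε, KobayashiMainConjecture W p ε` at an X7 SMALL-IMAGE pair ON THE PARITY STRATUM,
granted Conjecture A at the pair and the prints**: odd `p`, `ClassX7 W p`, `a_p = 0`, and for SOME sign `ε` the
certificate `(μ, λ)(L_p^ε) = (0, ≤ 1)` for the newform of level `N_E`. The crux's binders `¬ W.HasCM` and
`¬ Surj W p` are displayed verbatim and NOT used. READING for item 19002: on the sub-population of its domain where
one signed `p`-adic `L`-function has `p`-adic analytic rank `≤ 1` and `μ = 0`, the crux holds modulo print and
Coates–Sujatha's Conjecture A — no engine, rider or `λ`-part child is needed there.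
[cite: Kobayashi2003, Thm. 1.2, Thm. 4.1 and Conjecture (p. 2)] [cite: CoatesSujatha2005, Conjecture A]
[cite: DokchitserDokchitserAnnals2010, Thm. 1.4] [cite: Sprung2017, Cor. 4.14 (a_p = 0 display)] -/
theorem X7.exists_kobayashiMainConjecture_of_lam_le_one_of_conjectureA
    (hCK : thm62_63_73_signedColemanKato_zeta)
    (h12 : Kobayashi2003.thm12_signedSelmerDual_finite_torsion)
    (h41 : Kobayashi2003.thm41_signedCharIdeal_divisibility)
    (h5 : realPeriodRat_eq_unit_mul_plusPeriod) (h3 : realPeriodRat_eq_unit_mul_plusPeriod_three)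
    (hpar : p_parity W p) (hp : p ≠ 2) (hX : ClassX7 W p) (_hCM : ¬ W.HasCM) (hap : W.frobeniusTrace p = 0)
    (_hs : ¬ Surj W p)
    (hA : ∀ (κ : ZpExtension ℚ p), κ.IsCyclotomic →
      ∃ (γ : absoluteGaloisGroup ℚ) (Y : W.FineSelmerDualData κ γ),
        Module.Finite ℤ_[p] (RestrictScalars ℤ_[p] (IwasawaAlgebra p) Y.X))
    [NeZero (W.conductorNorm ℤ)] {f₀ : CuspForm (Gamma0 (W.conductorNorm ℤ)) 2} (hf₀ : IsNewformOf W f₀)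
    {ε : ℤˣ} (hcert₀ : ∀ L : IwasawaAlgebra p, IsSignedPAdicLFunction f₀ p ε L → mu L = 0 ∧ lam L ≤ 1) :
    ∃ ε : ℤˣ, KobayashiMainConjecture W p ε :=
  ⟨ε, kobayashiMainConjecture_of_lam_le_one_of_conjectureA W p hCK h12 h41 h5 h3 hpar hp hX.1.1 hap hA ε hf₀
    hcert₀⟩

end X7

/-! ## §3. Crux 4 BY NAME ⟺ its off-stratum part, modulo Conjecture A and the prints -/

section Crux

/-- **Crux 4 BY NAME from its OFF-STRATUM part, granted Conjecture A on the domain and the prints.** Hypotheses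
BY NAME: `hCK h12 h41 h5 h3` (Kobayashi 2003 / Kato / the period units), `hpar` (the `p`-parity theorem for every
`(W, p)`), `hA` (Conjecture A on the crux's domain, per-pair spelling), and `hoff` — THE OFF-STRATUM PART: at every
X7 ∧ ¬CM ∧ `a_p = 0` ∧ ¬Surj pair at odd `p` such that for the newform `f₀` of level `N_E` and BOTH signs `ε`
Pollack's `L_p^ε` has `λ ≥ 2` whenever `μ = 0`, the Eisenstein half `∃ ε, KobayashiLowerDivisibility W p ε` holds.
Conclusion: `Theses.SignedLowerHalves.KobayashiMainConjectureSmallImage`. Proof: the class-wide Eisenstein half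
(on the stratum: `LargeImageParityStratum.kobayashiLowerDivisibility_of_lam_le_one'`; off it: `hoff`; no newform
of level `N_E`: vacuous), then `SmallImageSignedMuDefect.kobayashiMainConjectureSmallImage_of_lower_of_conjectureA`.
CALIBRATION ONLY: the crux is not proved; this says WHERE its content lies (off the stratum) and WHAT ELSE it costs
(Conjecture A). [cite: Kobayashi2003, Thm. 1.2, Thm. 4.1 and Conjecture (p. 2)] [cite: CoatesSujatha2005, Conjecture A]
[cite: DokchitserDokchitserAnnals2010, Thm. 1.4] [cite: Pollack2003, Prop. 6.9 (proof) and Prop. 6.18] -/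
theorem kobayashiMainConjectureSmallImage_of_offStratum_of_conjectureA
    (hCK : thm62_63_73_signedColemanKato_zeta)
    (h12 : Kobayashi2003.thm12_signedSelmerDual_finite_torsion)
    (h41 : Kobayashi2003.thm41_signedCharIdeal_divisibility)
    (h5 : realPeriodRat_eq_unit_mul_plusPeriod) (h3 : realPeriodRat_eq_unit_mul_plusPeriod_three)
    (hpar : ∀ (W : WeierstrassCurve ℚ) [W.IsElliptic] (p : ℕ) [Fact p.Prime], p_parity W p)
    (hA : ∀ (W : WeierstrassCurve ℚ) [W.IsElliptic] [W.IsGloballyMinimal] (p : ℕ) [Fact p.Prime],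
      p ≠ 2 → ClassX7 W p → ¬ W.HasCM → W.frobeniusTrace p = 0 → ¬ Surj W p →
      ∀ (κ : ZpExtension ℚ p), κ.IsCyclotomic →
        ∃ (γ : absoluteGaloisGroup ℚ) (Y : W.FineSelmerDualData κ γ),
          Module.Finite ℤ_[p] (RestrictScalars ℤ_[p] (IwasawaAlgebra p) Y.X))
    (hoff : ∀ (W : WeierstrassCurve ℚ) [W.IsElliptic] [W.IsGloballyMinimal] (p : ℕ) [Fact p.Prime],
      p ≠ 2 → ClassX7 W p → ¬ W.HasCM → W.frobeniusTrace p = 0 → ¬ Surj W p →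
      (∀ [NeZero (W.conductorNorm ℤ)] (f₀ : CuspForm (Gamma0 (W.conductorNorm ℤ)) 2),
        IsNewformOf W f₀ → ∀ (ε : ℤˣ) (L : IwasawaAlgebra p),
          IsSignedPAdicLFunction f₀ p ε L → mu L = 0 → 2 ≤ lam L) →
      ∃ ε : ℤˣ, KobayashiLowerDivisibility W p ε) :
    Summit.BirchSwinnertonDyer.BirchSwinnertonDyer.Theses.SignedLowerHalves.KobayashiMainConjectureSmallImage := by
  refine SmallImageSignedMuDefect.kobayashiMainConjectureSmallImage_of_lower_of_conjectureA hCK h12 h41 h5 h3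
    ?_ hA
  intro W _ _ p _ hp hX hCM hap hs
  by_cases hmod : ∃ (_ : NeZero (W.conductorNorm ℤ)) (f₀ : CuspForm (Gamma0 (W.conductorNorm ℤ)) 2),
      IsNewformOf W f₀
  · obtain ⟨inst, f₀, hf₀⟩ := hmod
    by_cases hon : ∃ ε : ℤˣ, ∀ L : IwasawaAlgebra p,
        IsSignedPAdicLFunction f₀ p ε L → mu L = 0 ∧ lam L ≤ 1
    · -- on the stratum: the Eisenstein half by parity (no image hypothesis)
      obtain ⟨ε, hcert⟩ := hon
      exact ⟨ε, LargeImageParityStratum.kobayashiLowerDivisibility_of_lam_le_one' W p h12 h5 h3 (hpar W p) hp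
        hX.1.1 hap ε hf₀ hcert⟩
    · -- off the stratum: `hoff`
      refine hoff W p hp hX hCM hap hs fun f₁ hf₁ ε L hL hμ ↦ ?_
      have hff : f₁ = f₀ := hf₁.unique hf₀
      subst hff
      by_contra hlt
      refine hon ⟨ε, fun L' hL' ↦ ?_⟩
      have hLL : L' = L := hL'.unique hL
      subst hLL
      exact ⟨hμ, by omega⟩
  · -- no newform of level `N_W`: the divisibility is vacuous
    refine ⟨1, ?_⟩
    intro κ γ _ _ _ inst f hf
    exact absurd ⟨inst, f, hf⟩ hmod

/-- **Crux 4 BY NAME from its off-stratum part, Conjecture A as the tree NODE BY NAME**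
(`Rank1Residual.FineSelmer.CoatesSujathaConjectureA`) and the prints. [cite: CoatesSujatha2005, Conjecture A]
[cite: Kobayashi2003, Thm. 1.2, Thm. 4.1 and Conjecture (p. 2)] [cite: DokchitserDokchitserAnnals2010, Thm. 1.4] -/
theorem kobayashiMainConjectureSmallImage_of_offStratum_of_coatesSujathaConjectureA
    (hA : Summit.BirchSwinnertonDyer.Rank1Residual.FineSelmer.CoatesSujathaConjectureA)
    (hCK : thm62_63_73_signedColemanKato_zeta)
    (h12 : Kobayashi2003.thm12_signedSelmerDual_finite_torsion)
    (h41 : Kobayashi2003.thm41_signedCharIdeal_divisibility)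
    (h5 : realPeriodRat_eq_unit_mul_plusPeriod) (h3 : realPeriodRat_eq_unit_mul_plusPeriod_three)
    (hpar : ∀ (W : WeierstrassCurve ℚ) [W.IsElliptic] (p : ℕ) [Fact p.Prime], p_parity W p)
    (hoff : ∀ (W : WeierstrassCurve ℚ) [W.IsElliptic] [W.IsGloballyMinimal] (p : ℕ) [Fact p.Prime],
      p ≠ 2 → ClassX7 W p → ¬ W.HasCM → W.frobeniusTrace p = 0 → ¬ Surj W p →
      (∀ [NeZero (W.conductorNorm ℤ)] (f₀ : CuspForm (Gamma0 (W.conductorNorm ℤ)) 2),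
        IsNewformOf W f₀ → ∀ (ε : ℤˣ) (L : IwasawaAlgebra p),
          IsSignedPAdicLFunction f₀ p ε L → mu L = 0 → 2 ≤ lam L) →
      ∃ ε : ℤˣ, KobayashiLowerDivisibility W p ε) :
    Summit.BirchSwinnertonDyer.BirchSwinnertonDyer.Theses.SignedLowerHalves.KobayashiMainConjectureSmallImage :=
  kobayashiMainConjectureSmallImage_of_offStratum_of_conjectureA hCK h12 h41 h5 h3 hpar
    (fun W _ _ p _ hp _ _ _ _ κ hκ ↦ hA ℚ W p hp κ hκ) hoff

/-- **The converse (trivial): crux 4 implies its off-stratum Eisenstein part** (the main conjecture for a sign gives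
its Eisenstein half, `kobayashiLowerDivisibility_of_mainConjecture`). [cite: Kobayashi2003, Conjecture (p. 2)] -/
theorem offStratum_of_kobayashiMainConjectureSmallImage
    (h : Summit.BirchSwinnertonDyer.BirchSwinnertonDyer.Theses.SignedLowerHalves.KobayashiMainConjectureSmallImage) :
    ∀ (W : WeierstrassCurve ℚ) [W.IsElliptic] [W.IsGloballyMinimal] (p : ℕ) [Fact p.Prime],
      p ≠ 2 → ClassX7 W p → ¬ W.HasCM → W.frobeniusTrace p = 0 → ¬ Surj W p →
      (∀ [NeZero (W.conductorNorm ℤ)] (f₀ : CuspForm (Gamma0 (W.conductorNorm ℤ)) 2),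
        IsNewformOf W f₀ → ∀ (ε : ℤˣ) (L : IwasawaAlgebra p),
          IsSignedPAdicLFunction f₀ p ε L → mu L = 0 → 2 ≤ lam L) →
      ∃ ε : ℤˣ, KobayashiLowerDivisibility W p ε := by
  intro W _ _ p _ hp hX hCM hap hs _
  obtain ⟨ε, hε⟩ := h W p hp hX hCM hap hs
  exact ⟨ε, kobayashiLowerDivisibility_of_mainConjecture hε⟩

/-- **Crux 4 BY NAME ⟺ its off-stratum Eisenstein part, modulo Conjecture A (node) and the prints.** READING: the
content of item 19002 beyond Coates–Sujatha's Conjecture A and published theorems is carried entirely by the X7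
small-image pairs at which BOTH signed `p`-adic `L`-functions have `λ ≥ 2` or `μ ≥ 1` — the same shape as crux 3's
reading `LargeImageParityStratum.kobayashiLowerHalfLargeImage_iff_offStratum`, with Conjecture A paying for the
`p`-power that Kato's inclusion loses at non-surjective image. CALIBRATION ONLY.
[cite: Kobayashi2003, Thm. 1.2, Thm. 4.1 and Conjecture (p. 2)] [cite: CoatesSujatha2005, Conjecture A]
[cite: DokchitserDokchitserAnnals2010, Thm. 1.4] -/
theorem kobayashiMainConjectureSmallImage_iff_offStratum
    (hA : Summit.BirchSwinnertonDyer.Rank1Residual.FineSelmer.CoatesSujathaConjectureA)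
    (hCK : thm62_63_73_signedColemanKato_zeta)
    (h12 : Kobayashi2003.thm12_signedSelmerDual_finite_torsion)
    (h41 : Kobayashi2003.thm41_signedCharIdeal_divisibility)
    (h5 : realPeriodRat_eq_unit_mul_plusPeriod) (h3 : realPeriodRat_eq_unit_mul_plusPeriod_three)
    (hpar : ∀ (W : WeierstrassCurve ℚ) [W.IsElliptic] (p : ℕ) [Fact p.Prime], p_parity W p) :
    Summit.BirchSwinnertonDyer.BirchSwinnertonDyer.Theses.SignedLowerHalves.KobayashiMainConjectureSmallImage ↔
    ∀ (W : WeierstrassCurve ℚ) [W.IsElliptic] [W.IsGloballyMinimal] (p : ℕ) [Fact p.Prime],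
      p ≠ 2 → ClassX7 W p → ¬ W.HasCM → W.frobeniusTrace p = 0 → ¬ Surj W p →
      (∀ [NeZero (W.conductorNorm ℤ)] (f₀ : CuspForm (Gamma0 (W.conductorNorm ℤ)) 2),
        IsNewformOf W f₀ → ∀ (ε : ℤˣ) (L : IwasawaAlgebra p),
          IsSignedPAdicLFunction f₀ p ε L → mu L = 0 → 2 ≤ lam L) →
      ∃ ε : ℤˣ, KobayashiLowerDivisibility W p ε :=
  ⟨offStratum_of_kobayashiMainConjectureSmallImage,
    kobayashiMainConjectureSmallImage_of_offStratum_of_coatesSujathaConjectureA hA hCK h12 h41 h5 h3 hpar⟩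

end Crux

end Summit.BirchSwinnertonDyer.BirchSwinnertonDyer.Theorems.SmallImageParityStratum

end
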